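import Mathlib.Analysis.SpecialFunctions.Pow.Asymptotics
import Mathlib.Analysis.SpecialFunctions.Pow.Continuity
import Mathlib.Analysis.SpecialFunctions.Trigonometric.Bounds
import Mathlib.Analysis.Calculus.Deriv.MeanValue
import Mathlib.MeasureTheory.Integral.IntervalIntegral.Basic
import HarnessLib

/-!
# OSW separable blow-up, THEOREM E2 discharged — part 1: the one-variable growth lemmas and the kernel integrability

HONEST FRAMING (cells pub-oswblow / ns-blowup; 1-D MODEL (gCLM/OSW on the circle), computer-assisted context; not Euler/NS).

Pure one-variable calculus used by `OSWAprioriWindow.lean` to discharge every analytic hypothesis of the cell's LAW.md THEOREM E2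
(`OkamotoSakajoWunsch2008/AprioriBounds.lean` = arithmetic step, `OSWAprioriAnalyticStep.lean` = limit step) for the typed target
`AnalyticSeparableProfile` of `SeparableBlowup.lean`:

* `monotoneOn_div_rpow` / `antitoneOn_div_rpow`: for `F > 0` differentiable on `(0, δ)`, `y ↦ F(y)/y^q` is monotone where the
  logarithmic order `y·F′(y)/F(y) ≥ q` and antitone where `≤ q` (logarithmic derivative + `monotoneOn_of_hasDerivWithinAt_nonneg`);
* `one_le_of_tendsto_logDeriv`: a function vanishing at least linearly at `0⁺` (`F(y) ≤ L·y`, e.g. `C¹` with `F(0) = 0`) whose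
  logarithmic order has a limit `m` has `m ≥ 1`;
* `eq_natCast_of_tendsto_logDeriv`: if moreover `F(y)/y^P → κ ≠ 0` then the limit of the logarithmic order IS `P`;
* `tendsto_logDeriv_of_profileEq`: on a solution of the separable-blow-up profile equation `f = −a·g·f′ + f·h` with `f ≠ 0`, `a ≠ 0`,
  `g(x)/x → H₀ ≠ 0` and `h → H₀`, the logarithmic order `x f′/f` CONVERGES, to `(H₀ − 1)/(a·H₀)` — the vanishing-order hypothesis of
  E2 is automatic and the E2 identity `(1 − a·m)·H₀ = 1` is then a tautology;
* `intervalIntegrable_mul_cot_half` / `intervalIntegrable_mul_tan_half`: for continuous `f` with `|f(y)| ≤ L·y` (resp. `≤ L·(π − y)`)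
  on `[0, π]` the kernels `f·cot(·/2)`, `f·tan(·/2)` of the endpoint formulas for `Hf(0)`, `Hf(π)` are interval-integrable on `[0, π]`
  (bounded by `Lπ`, Jordan's inequality).

No definition, no named fact; nothing here mentions the OSW objects.
-/

noncomputable section

namespace Summit.NavierStokesRegularity.OSWSelfSimilar
namespace OSWAprioriWindow

open _root_.MeasureTheory _root_.Set _root_.Filter
open scoped Real Topology

/-! ### One-variable growth lemmas (logarithmic derivative) -/

/-- `exp(log F − q·log y) = F / y^q` for `F, y > 0`. [folklore] -/
private theorem exp_log_sub (F y q : ℝ) (hF : 0 < F) (hy : 0 < y) :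
    Real.exp (Real.log F - q * Real.log y) = F / y ^ q := by
  rw [Real.exp_sub, Real.exp_log hF, Real.rpow_def_of_pos hy, mul_comm]

/-- If `F > 0` is differentiable on `(0, δ)` with `q ≤ y·F′(y)/F(y)` there, then `y ↦ F(y)/y^q` is monotone on `(0, δ)`
(the logarithmic derivative of `F/y^q` is `(yF′/F − q)/y ≥ 0`). [folklore] -/
theorem monotoneOn_div_rpow {F F' : ℝ → ℝ} {δ q : ℝ}
    (hF : ∀ y ∈ Ioo 0 δ, HasDerivAt F (F' y) y) (hpos : ∀ y ∈ Ioo 0 δ, 0 < F y)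
    (hq : ∀ y ∈ Ioo 0 δ, q ≤ y * F' y / F y) :
    MonotoneOn (fun y => F y / y ^ q) (Ioo 0 δ) := by
  have hφ : ∀ y ∈ Ioo 0 δ, HasDerivAt (fun y => Real.log (F y) - q * Real.log y) (F' y / F y - q * y⁻¹) y :=
    fun y hy => ((hF y hy).log (hpos y hy).ne').sub ((Real.hasDerivAt_log (ne_of_gt hy.1)).const_mul q)
  have hmono : MonotoneOn (fun y => Real.log (F y) - q * Real.log y) (Ioo 0 δ) := by
    refine monotoneOn_of_hasDerivWithinAt_nonneg (f' := fun y => F' y / F y - q * y⁻¹) (convex_Ioo 0 δ)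
      (fun y hy => (hφ y hy).continuousAt.continuousWithinAt) ?_ ?_
    · intro y hy
      rw [interior_Ioo] at hy ⊢
      exact (hφ y hy).hasDerivWithinAt
    · intro y hy
      rw [interior_Ioo] at hy
      have hy0 : 0 < y := hy.1
      have hFy : 0 < F y := hpos y hy
      have h1 : q ≤ y * F' y / F y := hq y hy
      have h2 : F' y / F y - q * y⁻¹ = (y * F' y / F y - q) / y := by
        field_simp
      rw [h2]
      exact div_nonneg (by linarith) hy0.le
  intro y₁ hy₁ y₂ hy₂ h12
  have := Real.exp_le_exp.mpr (hmono hy₁ hy₂ h12)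
  simp only at this
  rwa [exp_log_sub _ _ _ (hpos y₁ hy₁) hy₁.1, exp_log_sub _ _ _ (hpos y₂ hy₂) hy₂.1] at this

/-- If `F > 0` is differentiable on `(0, δ)` with `y·F′(y)/F(y) ≤ q` there, then `y ↦ F(y)/y^q` is antitone on `(0, δ)`. [folklore] -/
theorem antitoneOn_div_rpow {F F' : ℝ → ℝ} {δ q : ℝ}
    (hF : ∀ y ∈ Ioo 0 δ, HasDerivAt F (F' y) y) (hpos : ∀ y ∈ Ioo 0 δ, 0 < F y)
    (hq : ∀ y ∈ Ioo 0 δ, y * F' y / F y ≤ q) :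
    AntitoneOn (fun y => F y / y ^ q) (Ioo 0 δ) := by
  have hφ : ∀ y ∈ Ioo 0 δ, HasDerivAt (fun y => Real.log (F y) - q * Real.log y) (F' y / F y - q * y⁻¹) y :=
    fun y hy => ((hF y hy).log (hpos y hy).ne').sub ((Real.hasDerivAt_log (ne_of_gt hy.1)).const_mul q)
  have hanti : AntitoneOn (fun y => Real.log (F y) - q * Real.log y) (Ioo 0 δ) := by
    refine antitoneOn_of_hasDerivWithinAt_nonpos (f' := fun y => F' y / F y - q * y⁻¹) (convex_Ioo 0 δ)
      (fun y hy => (hφ y hy).continuousAt.continuousWithinAt) ?_ ?_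
    · intro y hy
      rw [interior_Ioo] at hy ⊢
      exact (hφ y hy).hasDerivWithinAt
    · intro y hy
      rw [interior_Ioo] at hy
      have hy0 : 0 < y := hy.1
      have hFy : 0 < F y := hpos y hy
      have h1 : y * F' y / F y ≤ q := hq y hy
      have h2 : F' y / F y - q * y⁻¹ = (y * F' y / F y - q) / y := by
        field_simp
      rw [h2]
      exact div_nonpos_of_nonpos_of_nonneg (by linarith) hy0.le
  intro y₁ hy₁ y₂ hy₂ h12
  have := Real.exp_le_exp.mpr (hanti hy₁ hy₂ h12)
  simp only at this
  rwa [exp_log_sub _ _ _ (hpos y₁ hy₁) hy₁.1, exp_log_sub _ _ _ (hpos y₂ hy₂) hy₂.1] at this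

/-- A property holding eventually in `𝓝[>] 0` holds on some interval `(0, ε)`. [folklore] -/
private theorem exists_Ioo_of_eventually {p : ℝ → Prop} (h : ∀ᶠ y in 𝓝[>] (0 : ℝ), p y) :
    ∃ ε > 0, ∀ y ∈ Ioo 0 ε, p y := by
  rcases (mem_nhdsGT_iff_exists_Ioo_subset).mp h with ⟨ε, hε, hsub⟩
  exact ⟨ε, hε, fun y hy => hsub hy⟩

/-- **Order at least one.** If `F > 0` on `(0, δ)` is differentiable there, vanishes at least linearly (`F(y) ≤ L·y`, e.g. `F ∈ C¹`
with `F(0) = 0`), and the logarithmic order `y·F′(y)/F(y)` has a limit `m` as `y → 0⁺`, then `m ≥ 1`. [folklore] -/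
theorem one_le_of_tendsto_logDeriv {F F' : ℝ → ℝ} {δ m L : ℝ} (hδ : 0 < δ)
    (hF : ∀ y ∈ Ioo 0 δ, HasDerivAt F (F' y) y) (hpos : ∀ y ∈ Ioo 0 δ, 0 < F y)
    (hlin : ∀ y ∈ Ioo 0 δ, F y ≤ L * y)
    (hm : Tendsto (fun y => y * F' y / F y) (𝓝[>] 0) (𝓝 m)) : 1 ≤ m := by
  by_contra hm1'
  have hm1 : m < 1 := not_le.mp hm1'
  -- pick `q ∈ (m, 1)`; eventually `yF′/F ≤ q`
  set q : ℝ := (m + 1) / 2 with hq_def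
  have hmq : m < q := by rw [hq_def]; linarith
  have hq1 : q < 1 := by rw [hq_def]; linarith
  obtain ⟨ε, hε, hεq⟩ := exists_Ioo_of_eventually (hm.eventually (Iio_mem_nhds hmq))
  set δ' : ℝ := min δ ε with hδ'_def
  have hδ' : 0 < δ' := lt_min hδ hε
  have hsub : ∀ y ∈ Ioo 0 δ', y ∈ Ioo 0 δ := fun y hy => ⟨hy.1, lt_of_lt_of_le hy.2 (min_le_left _ _)⟩
  have hsub' : ∀ y ∈ Ioo 0 δ', y ∈ Ioo 0 ε := fun y hy => ⟨hy.1, lt_of_lt_of_le hy.2 (min_le_right _ _)⟩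
  have hanti : AntitoneOn (fun y => F y / y ^ q) (Ioo 0 δ') :=
    antitoneOn_div_rpow (fun y hy => hF y (hsub y hy)) (fun y hy => hpos y (hsub y hy))
      (fun y hy => le_of_lt (hεq y (hsub' y hy)))
  -- reference point `y₀ = δ'/2` and constant `C = F(y₀)/y₀^q > 0`
  set y₀ : ℝ := δ' / 2 with hy₀_def
  have hy₀ : y₀ ∈ Ioo 0 δ' := ⟨by rw [hy₀_def]; linarith, by rw [hy₀_def]; linarith⟩
  set C : ℝ := F y₀ / y₀ ^ q with hC_def
  have hC : 0 < C := div_pos (hpos y₀ (hsub y₀ hy₀)) (Real.rpow_pos_of_pos hy₀.1 q)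
  -- for `y ≤ y₀`: `C ≤ F(y)/y^q`, hence `C ≤ L · y^{1−q}`
  have hbound : ∀ y ∈ Ioo 0 y₀, C ≤ L * y ^ (1 - q) := by
    intro y hy
    have hy' : y ∈ Ioo 0 δ' := ⟨hy.1, lt_trans hy.2 hy₀.2⟩
    have h1 : C ≤ F y / y ^ q := hanti hy' hy₀ hy.2.le
    have hyq : 0 < y ^ q := Real.rpow_pos_of_pos hy.1 q
    have h2 : F y / y ^ q ≤ L * y / y ^ q := div_le_div_of_nonneg_right (hlin y (hsub y hy')) hyq.le
    have h3 : L * y / y ^ q = L * y ^ (1 - q) := by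
      rw [Real.rpow_sub hy.1, Real.rpow_one, mul_div_assoc]
    linarith [h3 ▸ h2]
  -- but `L · y^{1−q} → 0` as `y → 0⁺`
  have hlim : Tendsto (fun y : ℝ => L * y ^ (1 - q)) (𝓝[>] 0) (𝓝 0) := by
    have h1 : Tendsto (fun y : ℝ => y ^ (1 - q)) (𝓝[>] 0) (𝓝 0) := by
      have hc : ContinuousAt (fun y : ℝ => y ^ (1 - q)) 0 :=
        Real.continuousAt_rpow_const 0 (1 - q) (Or.inr (by linarith))
      have := hc.tendsto
      rw [Real.zero_rpow (by linarith)] at this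
      exact this.mono_left nhdsWithin_le_nhds
    simpa using h1.const_mul L
  have hev : ∀ᶠ y in 𝓝[>] (0 : ℝ), L * y ^ (1 - q) < C ∧ y ∈ Ioo 0 y₀ :=
    (hlim.eventually (Iio_mem_nhds hC)).and (Ioo_mem_nhdsGT hy₀.1)
  obtain ⟨y, hy1, hy2⟩ := hev.exists
  exact absurd (hbound y hy2) (not_le.mpr hy1)

/-- **Exact order from a power-law limit.** If `F > 0` on `(0, δ)` is differentiable there, the logarithmic order `y·F′(y)/F(y)` has a
limit `p` as `y → 0⁺`, and `F(y)/y^P → κ ≠ 0` for a natural number `P`, then `p = P`. [folklore] -/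
theorem eq_natCast_of_tendsto_logDeriv {F F' : ℝ → ℝ} {δ p κ : ℝ} {P : ℕ} (hδ : 0 < δ)
    (hF : ∀ y ∈ Ioo 0 δ, HasDerivAt F (F' y) y) (hpos : ∀ y ∈ Ioo 0 δ, 0 < F y)
    (hp : Tendsto (fun y => y * F' y / F y) (𝓝[>] 0) (𝓝 p))
    (hκ : Tendsto (fun y => F y / y ^ P) (𝓝[>] 0) (𝓝 κ)) (hκ0 : κ ≠ 0) : p = P := by
  -- rewrite the natural power as a real power
  have hκ' : Tendsto (fun y => F y / y ^ (P : ℝ)) (𝓝[>] 0) (𝓝 κ) := by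
    refine hκ.congr' ?_
    filter_upwards [self_mem_nhdsWithin] with y hy
    rw [Real.rpow_natCast]
  rcases lt_trichotomy p P with hlt | heq | hgt
  · -- `p < P`: `F/y^q` antitone for `q ∈ (p, P)` ⇒ `F/y^P ≥ C y^{q−P} → ∞`
    exfalso
    set q : ℝ := (p + P) / 2 with hq_def
    have hpq : p < q := by rw [hq_def]; linarith
    have hqP : q < P := by rw [hq_def]; linarith
    obtain ⟨ε, hε, hεq⟩ := exists_Ioo_of_eventually (hp.eventually (Iio_mem_nhds hpq))
    set δ' : ℝ := min δ ε with hδ'_def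
    have hδ' : 0 < δ' := lt_min hδ hε
    have hsub : ∀ y ∈ Ioo 0 δ', y ∈ Ioo 0 δ := fun y hy => ⟨hy.1, lt_of_lt_of_le hy.2 (min_le_left _ _)⟩
    have hsub' : ∀ y ∈ Ioo 0 δ', y ∈ Ioo 0 ε := fun y hy => ⟨hy.1, lt_of_lt_of_le hy.2 (min_le_right _ _)⟩
    have hanti : AntitoneOn (fun y => F y / y ^ q) (Ioo 0 δ') :=
      antitoneOn_div_rpow (fun y hy => hF y (hsub y hy)) (fun y hy => hpos y (hsub y hy))
        (fun y hy => le_of_lt (hεq y (hsub' y hy)))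
    set y₀ : ℝ := δ' / 2 with hy₀_def
    have hy₀ : y₀ ∈ Ioo 0 δ' := ⟨by rw [hy₀_def]; linarith, by rw [hy₀_def]; linarith⟩
    set C : ℝ := F y₀ / y₀ ^ q with hC_def
    have hC : 0 < C := div_pos (hpos y₀ (hsub y₀ hy₀)) (Real.rpow_pos_of_pos hy₀.1 q)
    have hbound : ∀ y ∈ Ioo 0 y₀, C * y ^ (q - P) ≤ F y / y ^ (P : ℝ) := by
      intro y hy
      have hy' : y ∈ Ioo 0 δ' := ⟨hy.1, lt_trans hy.2 hy₀.2⟩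
      have h1 : C ≤ F y / y ^ q := hanti hy' hy₀ hy.2.le
      have h2 : F y / y ^ (P : ℝ) = F y / y ^ q * y ^ (q - P) := by
        rw [Real.rpow_sub hy.1, mul_div_assoc', div_mul_cancel₀ _ (Real.rpow_pos_of_pos hy.1 q).ne']
      rw [h2]
      exact mul_le_mul_of_nonneg_right h1 (Real.rpow_pos_of_pos hy.1 _).le
    have hlow : Tendsto (fun y : ℝ => C * y ^ (q - P)) (𝓝[>] 0) atTop :=
      Tendsto.const_mul_atTop hC (tendsto_rpow_neg_nhdsGT_zero (by linarith))
    have htop : Tendsto (fun y => F y / y ^ (P : ℝ)) (𝓝[>] 0) atTop := by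
      refine tendsto_atTop_mono' _ ?_ hlow
      filter_upwards [Ioo_mem_nhdsGT hy₀.1] with y hy using hbound y hy
    exact not_tendsto_nhds_of_tendsto_atTop htop κ hκ'
  · exact heq
  · -- `P < p`: `F/y^q` monotone for `q ∈ (P, p)` ⇒ `0 < F/y^P ≤ C y^{q−P} → 0` ⇒ `κ = 0`
    exfalso
    set q : ℝ := (p + P) / 2 with hq_def
    have hqp : q < p := by rw [hq_def]; linarith
    have hPq : (P : ℝ) < q := by rw [hq_def]; linarith
    obtain ⟨ε, hε, hεq⟩ := exists_Ioo_of_eventually (hp.eventually (Ioi_mem_nhds hqp))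
    set δ' : ℝ := min δ ε with hδ'_def
    have hδ' : 0 < δ' := lt_min hδ hε
    have hsub : ∀ y ∈ Ioo 0 δ', y ∈ Ioo 0 δ := fun y hy => ⟨hy.1, lt_of_lt_of_le hy.2 (min_le_left _ _)⟩
    have hsub' : ∀ y ∈ Ioo 0 δ', y ∈ Ioo 0 ε := fun y hy => ⟨hy.1, lt_of_lt_of_le hy.2 (min_le_right _ _)⟩
    have hmono : MonotoneOn (fun y => F y / y ^ q) (Ioo 0 δ') :=
      monotoneOn_div_rpow (fun y hy => hF y (hsub y hy)) (fun y hy => hpos y (hsub y hy))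
        (fun y hy => le_of_lt (hεq y (hsub' y hy)))
    set y₀ : ℝ := δ' / 2 with hy₀_def
    have hy₀ : y₀ ∈ Ioo 0 δ' := ⟨by rw [hy₀_def]; linarith, by rw [hy₀_def]; linarith⟩
    set C : ℝ := F y₀ / y₀ ^ q with hC_def
    have hbound : ∀ y ∈ Ioo 0 y₀, F y / y ^ (P : ℝ) ≤ C * y ^ (q - P) := by
      intro y hy
      have hy' : y ∈ Ioo 0 δ' := ⟨hy.1, lt_trans hy.2 hy₀.2⟩
      have h1 : F y / y ^ q ≤ C := hmono hy' hy₀ hy.2.le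
      have h2 : F y / y ^ (P : ℝ) = F y / y ^ q * y ^ (q - P) := by
        rw [Real.rpow_sub hy.1, mul_div_assoc', div_mul_cancel₀ _ (Real.rpow_pos_of_pos hy.1 q).ne']
      rw [h2]
      exact mul_le_mul_of_nonneg_right h1 (Real.rpow_pos_of_pos hy.1 _).le
    have hup : Tendsto (fun y : ℝ => C * y ^ (q - P)) (𝓝[>] 0) (𝓝 0) := by
      have hc : ContinuousAt (fun y : ℝ => y ^ (q - P)) 0 :=
        Real.continuousAt_rpow_const 0 (q - P) (Or.inr (by linarith))
      have h1 := hc.tendsto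
      rw [Real.zero_rpow (by linarith)] at h1
      simpa using (h1.mono_left nhdsWithin_le_nhds).const_mul C
    have hzero : Tendsto (fun y => F y / y ^ (P : ℝ)) (𝓝[>] 0) (𝓝 0) := by
      refine tendsto_of_tendsto_of_tendsto_of_le_of_le' tendsto_const_nhds hup ?_ ?_
      · filter_upwards [Ioo_mem_nhdsGT hδ] with y hy
        exact (div_pos (hpos y hy) (Real.rpow_pos_of_pos hy.1 _)).le
      · filter_upwards [Ioo_mem_nhdsGT hy₀.1] with y hy using hbound y hy
    exact hκ0 (tendsto_nhds_unique hκ' hzero)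

/-- **The vanishing-order limit exists by the profile equation.** If on `(0, δ)` the equation `f = −a·g·f′ + f·h` holds with `f ≠ 0`,
`a ≠ 0`, and `g(x)/x → H₀ ≠ 0`, `h(x) → H₀` as `x → 0⁺`, then `x·f′(x)/f(x) → (H₀ − 1)/(a·H₀)`. [folklore] -/
theorem tendsto_logDeriv_of_profileEq {f f' g h : ℝ → ℝ} {a H₀ δ : ℝ} (hδ : 0 < δ) (ha : a ≠ 0) (hH : H₀ ≠ 0)
    (hT1 : ∀ x ∈ Ioo 0 δ, f x = -a * g x * f' x + f x * h x) (hf0 : ∀ x ∈ Ioo 0 δ, f x ≠ 0)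
    (hg : Tendsto (fun x => g x / x) (𝓝[>] 0) (𝓝 H₀)) (hh : Tendsto h (𝓝[>] 0) (𝓝 H₀)) :
    Tendsto (fun x => x * f' x / f x) (𝓝[>] 0) (𝓝 ((H₀ - 1) / (a * H₀))) := by
  have hlim : Tendsto (fun x => (h x - 1) / (a * (g x / x))) (𝓝[>] 0) (𝓝 ((H₀ - 1) / (a * H₀))) :=
    (hh.sub_const 1).div (hg.const_mul a) (mul_ne_zero ha hH)
  have hgne : ∀ᶠ x in 𝓝[>] (0 : ℝ), g x / x ≠ 0 := hg.eventually_ne hH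
  refine hlim.congr' ?_
  filter_upwards [hgne, Ioo_mem_nhdsGT hδ] with x hgx hx
  have hx0 : x ≠ 0 := ne_of_gt hx.1
  have hgx' : g x ≠ 0 := by
    intro h0; rw [h0, zero_div] at hgx; exact hgx rfl
  have e := hT1 x hx
  have hfx := hf0 x hx
  have key : a * g x * f' x = f x * (h x - 1) := by linear_combination e
  have h2 : x * f' x / f x = x * (h x - 1) / (a * g x) := by
    rw [div_eq_div_iff hfx (mul_ne_zero ha hgx')]
    linear_combination x * key
  rw [h2, mul_div_assoc', div_div_eq_mul_div, mul_comm (h x - 1) x]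


/-! ### Kernel integrability of `f·cot(·/2)` and `f·tan(·/2)` for a `C¹` profile vanishing at `0` and `π` -/

/-- If `f` is continuous with `|f(y)| ≤ L·y` on `[0, π]`, then `f·cot(·/2)` is interval-integrable on `[0, π]` (bounded by `Lπ`, by
Jordan's inequality `sin(y/2) ≥ y/π`). [folklore] -/
theorem intervalIntegrable_mul_cot_half {f : ℝ → ℝ} {L : ℝ} (hf : Continuous f) (hb : ∀ y ∈ Icc (0 : ℝ) π, |f y| ≤ L * y) :
    IntervalIntegrable (fun y => f y * (Real.cos (y / 2) / Real.sin (y / 2))) volume 0 π := by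
  rw [intervalIntegrable_iff_integrableOn_Ioc_of_le Real.pi_pos.le]
  have hm : Measurable fun y => f y * (Real.cos (y / 2) / Real.sin (y / 2)) :=
    hf.measurable.mul ((Real.measurable_cos.comp (measurable_id.div_const 2)).div
      (Real.measurable_sin.comp (measurable_id.div_const 2)))
  refine Measure.integrableOn_of_bounded (M := L * π) (by simp) hm.aestronglyMeasurable ?_
  refine ae_restrict_of_forall_mem measurableSet_Ioc fun y hy => ?_
  have hy0 : 0 < y := hy.1
  have hyπ : y ≤ π := hy.2
  have hsin : y / π ≤ Real.sin (y / 2) := by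
    have := Real.mul_le_sin (x := y / 2) (by linarith) (by linarith)
    convert this using 1
    field_simp
  have hsin_pos : 0 < Real.sin (y / 2) := lt_of_lt_of_le (div_pos hy0 Real.pi_pos) hsin
  have hfy : |f y| ≤ L * y := hb y ⟨hy0.le, hyπ⟩
  have hLy : 0 ≤ L * y := le_trans (abs_nonneg _) hfy
  rw [Real.norm_eq_abs, abs_mul, abs_div, abs_of_pos hsin_pos]
  have hfrac : |Real.cos (y / 2)| / Real.sin (y / 2) ≤ 1 / (y / π) :=
    div_le_div₀ zero_le_one (Real.abs_cos_le_one _) (div_pos hy0 Real.pi_pos) hsin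
  calc |f y| * (|Real.cos (y / 2)| / Real.sin (y / 2)) ≤ L * y * (1 / (y / π)) :=
        mul_le_mul hfy hfrac (div_nonneg (abs_nonneg _) hsin_pos.le) hLy
    _ = L * π := by field_simp

/-- If `f` is continuous with `|f(y)| ≤ L·(π − y)` on `[0, π]`, then `f·tan(·/2)` is interval-integrable on `[0, π]` (bounded by
`Lπ`, by Jordan's inequality `cos(y/2) = sin((π − y)/2) ≥ (π − y)/π`). [folklore] -/
theorem intervalIntegrable_mul_tan_half {f : ℝ → ℝ} {L : ℝ} (hf : Continuous f)
    (hb : ∀ y ∈ Icc (0 : ℝ) π, |f y| ≤ L * (π - y)) :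
    IntervalIntegrable (fun y => f y * (Real.sin (y / 2) / Real.cos (y / 2))) volume 0 π := by
  rw [intervalIntegrable_iff_integrableOn_Ioc_of_le Real.pi_pos.le]
  have hm : Measurable fun y => f y * (Real.sin (y / 2) / Real.cos (y / 2)) :=
    hf.measurable.mul ((Real.measurable_sin.comp (measurable_id.div_const 2)).div
      (Real.measurable_cos.comp (measurable_id.div_const 2)))
  refine Measure.integrableOn_of_bounded (M := L * π) (by simp) hm.aestronglyMeasurable ?_
  refine ae_restrict_of_forall_mem measurableSet_Ioc fun y hy => ?_
  have hy0 : 0 < y := hy.1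
  have hyπ : y ≤ π := hy.2
  have hL : 0 ≤ L := by
    have h1 : |f (π / 2)| ≤ L * (π - π / 2) := hb (π / 2) ⟨by positivity, by linarith [Real.pi_pos]⟩
    have h2 : 0 ≤ L * (π - π / 2) := le_trans (abs_nonneg _) h1
    nlinarith [Real.pi_pos]
  rw [Real.norm_eq_abs, abs_mul]
  rcases eq_or_lt_of_le hyπ with h | h
  · -- `y = π`: the junk value `sin(π/2)/cos(π/2) = 1/0 = 0`
    rw [h, show π / 2 = π / 2 from rfl, Real.cos_pi_div_two, div_zero, abs_zero, mul_zero]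
    positivity
  · have hcos : (π - y) / π ≤ Real.cos (y / 2) := by
      have := Real.mul_le_sin (x := (π - y) / 2) (by linarith) (by linarith)
      rw [← Real.cos_pi_div_two_sub] at this
      convert this using 2
      · field_simp
      · ring
    have hcos_pos : 0 < Real.cos (y / 2) := lt_of_lt_of_le (div_pos (by linarith) Real.pi_pos) hcos
    have hfy : |f y| ≤ L * (π - y) := hb y ⟨hy0.le, hyπ⟩
    rw [abs_div, abs_of_pos hcos_pos]
    have hfrac : |Real.sin (y / 2)| / Real.cos (y / 2) ≤ 1 / ((π - y) / π) :=
      div_le_div₀ zero_le_one (Real.abs_sin_le_one _) (div_pos (by linarith) Real.pi_pos) hcos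
    calc |f y| * (|Real.sin (y / 2)| / Real.cos (y / 2)) ≤ L * (π - y) * (1 / ((π - y) / π)) :=
          mul_le_mul hfy hfrac (div_nonneg (abs_nonneg _) hcos_pos.le) (mul_nonneg hL (by linarith))
      _ = L * π := by
          have : π - y ≠ 0 := by linarith
          field_simp

end OSWAprioriWindow
end Summit.NavierStokesRegularity.OSWSelfSimilar

end
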